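import Summits.BirchSwinnertonDyer.Rank1Residual.F1Sign2.SymbolLineTransferAtTwo
import HarnessLib

/-!
# Cell `bsd-f1-sign2`, lens `-imc`: IMC-SYMB-Σ on `S₃`-IMAGE PAIRS — `SymbolLineTransferAtTwoSigmaRS3`, the `S₃` twin of
# `SymbolLineTransferAtTwoSigmaR` (Part C′ of `SymbolLineTransferAtTwo.lean`), filed by -ty g4 on a CONSUMER ask

STATEMENT ONLY + PROVED bookkeeping (ONE `@[conjecture] def` = open obligation, nothing asserted; the weakening from Part C′ and Part C′'s
glue restated, both PROVED; no named Literature fact, no `sorry`). A SIBLING file rather than a «Part F» append because the gate caps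
Theorems-side files with proofs at 400 lines (`SymbolLineTransferAtTwo.lean` has 387); same namespace
`Summit.BirchSwinnertonDyer.Rank1Residual.F1Sign2`, so consumers add one import and use the name.

TYPER FILING (seat `bsd-f1-sign2-ty` g4; CANDIDATES.md row IMC-SYMB-Σ(S₃)). REF1-AUDIT-v1 §48 (2026-08-28T00:33:34Z) answered the typer's scope question for Part C′ / Part D′: «no clause required on
SigmaR/Semistable; optional twins» (REF1 §46 (D6)'s `C₃` caveat was raised for the fixed-level dictionary; the planner of record's
ruling 2026-08-28T00:10:06Z: «same treatment for `…SigmaR` if REF1 §46 applies to it»). The twin is now CONSUMED: the lead prover of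
crux C1 `MainConjectureTransportAlignedAtTwo` (stmt-BirchSwinnertonDyer-22296; seat bsd-line-att-p1 g2, HOME/INBOX.md
2026-08-28T01:40:02Z) registered skeleton v4 `Cruxes/MainConjectureTransportAlignedAtTwo/Lines/birth.lean` (commit 2563312a5ba3) whose
open stub `stub_sigmaS3` is EXACTLY the body of `SymbolLineTransferAtTwoSigmaR` with the two binders `¬ IsSquare W₁.Δ → ¬ IsSquare W₂.Δ →`
inserted after the two no-rational-2-torsion clauses (the Part E convention), consumed by the landed
`Theorems/AlignedTransportAtTwoMainConjectureTransportAlignedAtTwoSharedCubicField.lean` (p593113,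
`mainConjectureTransportAlignedAtTwo_of_sigmaS3_of_analyticMuZeroAtTwo`, where the clause `¬ IsSquare W₂.Δ` is load-bearing) and asked
«if -ty files it as a named `@[conjecture] def SymbolLineTransferAtTwoSigmaRS3`, the stub becomes BY NAME». Filed here by the Part E
pattern: the NEW `@[conjecture] def` (Part C′'s statement is not touched — tree rule «supersede, never edit in place»; Part C′ stays the
stronger refutation target), the PROVED weakening from Part C′, and Part C′'s glue restated. Census / BC5: unchanged (every census
instance of IMC-SYMB-Σ is `S₃`: 105/105 + 2 180/2 180 + D-imc-9 1 201/1 201). Nothing asserted; no `sorry`; no Literature debt. PARTITION: none moved; beyond-print theorem: no. bears_on: `stmt-BirchSwinnertonDyer-22296`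
(C1 of route AlignedTransportAtTwo: `stub_sigmaS3` BY NAME).

APPEND (seat `bsd-f1-sign2-ty` g6, 2026-08-28; CANDIDATES.md row IMC-SYMB-Σ(RawS3)): `SymbolLineTransferAtTwoSigmaRawS3`, the RAW
(un-normalised) `Σ`-depleted mod-`2` identity on aligned good-ordinary `S₃` pairs with `red G₁ ≠ 0` — filed on the lead prover's ONE
filing ask (seat bsd-line-att-p1 g3, HOME/INBOX.md 2026-08-28T03:24:25Z): body = the `hRaw` binder of the landed
`Summit.BirchSwinnertonDyer.BirchSwinnertonDyer.Theorems.AlignedTransportAtTwoSigmaRaw.mainConjectureTransportAlignedAtTwo_of_sigmaRawS3`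
(p601032, `Theorems/AlignedTransportAtTwoMainConjectureTransportAlignedAtTwoSigmaRaw.lean`) VERBATIM, ordinarity binders included, so that
line `birth` v7 of crux C1 re-points its last open stub `stub_sigmaRawS3` BY NAME: C1 ⟸ `SymbolLineTransferAtTwoSigmaRawS3` + four
published facts (Kato 2004 Thm 17.4 (1)(2) at `2`, modularity, the period unit at `2`, Matsuno 2008 Thm 4.2). REF1-AUDIT-v1 §68
(2026-08-28T03:34:23Z, file a6…; evidence `HOME/REF1-data/b68/`, probe rc 0): SURVIVES conjecture-grade — typed = hRaw verbatim (e1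
`sigmaRawS3_of_sigmaRS3_of_analyticMuZeroAtTwo h hμ : …RawS3` and e2 `mainConjectureTransportAlignedAtTwo_of_sigmaRawS3 hRaw … : C1` both
compile against the def), junk-free (the lift predicate pins `G`; `red (-G) = red G` in characteristic `2`; the degenerate pair `W₁ = W₂` is
a true instance), BC7 CLEAN, faithful `p ↦ 2` transcription of Emerton–Pollack–Weston §4 (the unit of `k = 𝔽₂` is `1`; Cor. 4.3.3's `u`
specialises to an `O^×` constant) with EPW's multiplicity-one and canonical-period inputs carried INSIDE the conjecture (= the cell's
MULT2/CA and period currencies), strictly fewer open inputs than the v5 pair (the blanket `AnalyticMuZeroAtTwo` is replaced by the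
`μ`-TRANSFER along the congruence, Greenberg–Vatsal Thm. (1.4) shape); CLEARED «def only in this file». STRUCTURAL NOTE (REF1 §68 filing
note): the PROVED weakening `(SymbolLineTransferAtTwoSigmaRS3 ∧ AnalyticMuZeroAtTwo) ⇒ RawS3` stays in the Theorems file p601032
(`sigmaRawS3_of_sigmaRS3_of_analyticMuZeroAtTwo`) — it needs `order_map_toZMod_eulerFactorProductInv_two` /
`iwasawaToPowerSeries_eq_of_isEvenBranchLiftAtTwo_of_isOrdinaryAt` from the `BirchSwinnertonDyer/BirchSwinnertonDyer/Theorems` side, which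
imports this module (moving it here would close an import cycle). REF2: print placement of EPW at `p` odd (REF2 v16; [EPW06] fix «an odd
prime p», §4 «unit of k», Cor. 4.3.3, canonical periods) — the `p = 2` raw identity is OPEN, not in print. Census / BC5 (att-p1 g3): XSYM
105/105 + 2 180/2 180 + 1 201/1 201 aligned ⇒ equal, `μ = 0` on both sides of every row (so raw = unit-normalised on the census; the
`μ`-transfer content is untested as a transfer). Nothing asserted; no `sorry`; no Literature debt; net debt delta 0. PARTITION: none moved;
beyond-print theorem: no (C1 stays OPEN modulo RawS3 + 4 PRINT; BSD is not proved). bears_on: `stmt-BirchSwinnertonDyer-22296`.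
-/

noncomputable section

open scoped Classical MatrixGroups ModularForm
open CongruenceSubgroup Polynomial
open Literature.NumberTheory.EllipticCurves Literature.NumberTheory.EllipticCurves.ModularForms
open Literature.NumberTheory.EllipticCurves.Greenberg1999
open Literature.NumberTheory.EllipticCurves.Rank1Residual
open Summit.BirchSwinnertonDyer.Rank1Residual.X1.MuLambda
open Summit.BirchSwinnertonDyer.Rank1Residual.X5
open IsDedekindDomain NumberField

set_option autoImplicit false

namespace Summit.BirchSwinnertonDyer.Rank1Residual.F1Sign2

/-- **Candidate `SymbolLineTransferAtTwoSigmaRS3` (IMC-SYMB-Σ on `S₃`-image pairs = Part C′'s `SymbolLineTransferAtTwoSigmaR` with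
the `C₃` image excluded; REF1 §46 (D6) convention, REF1 §48 «optional twin», consumer bsd-line-att-p1 g2's `stub_sigmaS3`).** Body = the
body of `SymbolLineTransferAtTwoSigmaR` VERBATIM with the two binders `¬ IsSquare W₁.Δ → ¬ IsSquare W₂.Δ →` inserted after the two
no-rational-2-torsion clauses (with no rational 2-torsion, `¬ IsSquare Δ` ⟺ the mod-2 image is all of `GL₂(𝔽₂) ≅ S₃`, so the root pair
`(e₁, e₂)` in the common cubic field pins THE identification `E₁[2] ≅ E₂[2]`; the second binder is implied by the first under the
remaining hypotheses — `isSquare_Δ_iff_of_shared_cubic_field`, p593113 — and is kept for the symmetric Part E shape). Implied by the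
unrestricted Part C′ form (`symbolLineTransferAtTwoSigmaRS3_of`). ORIENTATION, census, why-it-might-fail and sources: as Part C′.
[cite: EmertonPollackWeston2006, Thm. 1, §§3–5] [cite: GreenbergVatsal2000, §1 (8)–(10), Prop. 2.4] -/
@[conjecture] def SymbolLineTransferAtTwoSigmaRS3 : Prop :=
  ∀ (W₁ : WeierstrassCurve ℚ) [W₁.IsElliptic] [W₁.IsGloballyMinimal]
    (W₂ : WeierstrassCurve ℚ) [W₂.IsElliptic] [W₂.IsGloballyMinimal],
    (∀ x : ℚ, ¬ HasRationalTwoTorsionX W₁ x) → (∀ x : ℚ, ¬ HasRationalTwoTorsionX W₂ x) →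
    ¬ IsSquare W₁.Δ → ¬ IsSquare W₂.Δ →
    ∀ (F : Type) [Field F] [NumberField F], Module.finrank ℚ F = 3 →
    ∀ e₁ e₂ : F, aeval e₁ (twoDivisionUCubic W₁) = 0 → aeval e₂ (twoDivisionUCubic W₂) = 0 →
    AlignedAtTwo F e₁ e₂ →
    AlignedAtInfinity F (twoDivisionUCubic W₁) (twoDivisionUCubic W₂) e₁ e₂ →
    ∀ ⦃N₁ : ℕ⦄ [NeZero N₁] (f₁ : CuspForm (Gamma0 N₁) 2), IsNewformOf W₁ f₁ →
    ∀ ⦃N₂ : ℕ⦄ [NeZero N₂] (f₂ : CuspForm (Gamma0 N₂) 2), IsNewformOf W₂ f₂ →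
    ∀ G₁ G₂ : IwasawaAlgebra 2, IsEvenBranchLiftAtTwo W₁ f₁ G₁ → IsEvenBranchLiftAtTwo W₂ f₂ G₂ →
    ∀ S : Finset (HeightOneSpectrum (𝓞 ℚ)),
      (∀ v ∈ S, Rat.HeightOneSpectrum.natGenerator v ≠ 2) →
      (∀ ℓ ∈ (N₁ * N₂).primeFactors, ℓ ≠ 2 → ∃ v ∈ S, Rat.HeightOneSpectrum.natGenerator v = ℓ) →
      red (pfree (G₁ * GreenbergVatsal2000.eulerFactorProductInv W₁ 2 S)) =
        red (pfree (G₂ * GreenbergVatsal2000.eulerFactorProductInv W₂ 2 S))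

/-- PROVED weakening: the unrestricted Part C′ statement implies its `S₃`-image form (introduce the binders, discard the two
discriminant clauses, apply the hypothesis). -/
theorem symbolLineTransferAtTwoSigmaRS3_of (h : SymbolLineTransferAtTwoSigmaR) : SymbolLineTransferAtTwoSigmaRS3 :=
  fun W₁ _ _ W₂ _ _ h₁ h₂ _ _ F _ _ hF e₁ e₂ he₁ he₂ h2 hinf _ _ f₁ hf₁ _ _ f₂ hf₂ G₁ G₂ hG₁ hG₂ S hS2 hS =>
    h W₁ W₂ h₁ h₂ F hF e₁ e₂ he₁ he₂ h2 hinf f₁ hf₁ f₂ hf₂ G₁ G₂ hG₁ hG₂ S hS2 hS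

/-- Bookkeeping (proved): Part C′'s glue `red_pfree_eq_of_symbolLineTransferAtTwoSigmaR` restated from the `S₃` form — on an
`S₃`-image pair whose `ι`-oriented depletion factors over a common admissible `S` have the same NON-ZERO mod-2 reduction, the
undepleted unit-normalised reductions agree. -/
theorem red_pfree_eq_of_symbolLineTransferAtTwoSigmaRS3 (h : SymbolLineTransferAtTwoSigmaRS3)
    (W₁ : WeierstrassCurve ℚ) [W₁.IsElliptic] [W₁.IsGloballyMinimal]
    (W₂ : WeierstrassCurve ℚ) [W₂.IsElliptic] [W₂.IsGloballyMinimal]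
    (h₁ : ∀ x : ℚ, ¬ HasRationalTwoTorsionX W₁ x) (h₂ : ∀ x : ℚ, ¬ HasRationalTwoTorsionX W₂ x)
    (hΔ₁ : ¬ IsSquare W₁.Δ) (hΔ₂ : ¬ IsSquare W₂.Δ)
    (F : Type) [Field F] [NumberField F] (hF : Module.finrank ℚ F = 3)
    (e₁ e₂ : F) (he₁ : aeval e₁ (twoDivisionUCubic W₁) = 0) (he₂ : aeval e₂ (twoDivisionUCubic W₂) = 0)
    (h2 : AlignedAtTwo F e₁ e₂)
    (hinf : AlignedAtInfinity F (twoDivisionUCubic W₁) (twoDivisionUCubic W₂) e₁ e₂)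
    {N₁ : ℕ} [NeZero N₁] (f₁ : CuspForm (Gamma0 N₁) 2) (hf₁ : IsNewformOf W₁ f₁)
    {N₂ : ℕ} [NeZero N₂] (f₂ : CuspForm (Gamma0 N₂) 2) (hf₂ : IsNewformOf W₂ f₂)
    (G₁ G₂ : IwasawaAlgebra 2) (hG₁ : IsEvenBranchLiftAtTwo W₁ f₁ G₁) (hG₂ : IsEvenBranchLiftAtTwo W₂ f₂ G₂)
    (S : Finset (HeightOneSpectrum (𝓞 ℚ)))
    (hS2 : ∀ v ∈ S, Rat.HeightOneSpectrum.natGenerator v ≠ 2)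
    (hS : ∀ ℓ ∈ (N₁ * N₂).primeFactors, ℓ ≠ 2 → ∃ v ∈ S, Rat.HeightOneSpectrum.natGenerator v = ℓ)
    (hP : red (GreenbergVatsal2000.eulerFactorProductInv W₁ 2 S) =
      red (GreenbergVatsal2000.eulerFactorProductInv W₂ 2 S))
    (hP0 : red (GreenbergVatsal2000.eulerFactorProductInv W₁ 2 S) ≠ 0) :
    red (pfree G₁) = red (pfree G₂) :=
  red_pfree_eq_of_depleted_eq hP hP0
    (h W₁ W₂ h₁ h₂ hΔ₁ hΔ₂ F hF e₁ e₂ he₁ he₂ h2 hinf f₁ hf₁ f₂ hf₂ G₁ G₂ hG₁ hG₂ S hS2 hS)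

/-! ## Append (-ty g6, 2026-08-28): the RAW `Σ`-depleted identity `SymbolLineTransferAtTwoSigmaRawS3` (att-p1 g3's filing ask) -/

/-- **Candidate `SymbolLineTransferAtTwoSigmaRawS3` (IMC-SYMB-Σ, RAW form on aligned good-ordinary `S₃` pairs; OPEN obligation — a
conjecture of ours, NOT a published result; REF1-AUDIT-v1 §68 SURVIVES conjecture-grade, CLEARED).** For every pair of globally minimal
curves `W₁, W₂ / ℚ`, both GOOD ORDINARY at `2`, both without rational `2`-torsion, both of non-square discriminant (mod-`2` image `S₃`),
sharing a cubic number field `F` generated by roots `e₁, e₂` of their `u`-cubics that are ALIGNED at `2` and at `∞`, for every pair of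
newforms `f₁, f₂` attached to them, every pair of even-branch `2`-adic lifts `G₁, G₂` WITH `red G₁ ≠ 0` (`μ(G₁) = 0` — a hypothesis),
and every finite set `S` of odd places containing a place above each odd prime of `N₁N₂`, the reductions mod `2` of the `S`-depleted
lifts agree in `𝔽₂⟦T⟧`:
`red (G₁ · ∏_{v∈S} 𝒫_v^ι(W₁)) = red (G₂ · ∏_{v∈S} 𝒫_v^ι(W₂))`.
This is Emerton–Pollack–Weston's Theorem 1 / §4 Cor. 4.3.3 read VERBATIM at `p = 2` on the crux's pairs: EPW's unit `u` is a constant of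
`O^× = ℤ₂ˣ`, hence `1` in `k = 𝔽₂`, so the congruence is an EQUALITY of reductions; EPW's standing inputs — mod-`p` multiplicity one of
the `ρ̄`-eigensymbol (here: «aligned at `2` and at `∞`», the cell's MULT2/CA currency) and canonical periods versus the tree lift's
normalisation `iwasawaToPowerSeries 2 G = padicLFunction f (unitRoot W 2)` — are carried INSIDE this conjecture, not assumed.
BODY = the `hRaw` binder of `…Theorems.AlignedTransportAtTwoSigmaRaw.mainConjectureTransportAlignedAtTwo_of_sigmaRawS3` (p601032)
VERBATIM (the depletion factor is written with its namespace, as elsewhere in this file). POSITION (tree-proved there): (`SymbolLineTransferAtTwoSigmaRS3` ∧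
`AnalyticMuZeroAtTwo`) ⇒ RawS3 (`sigmaRawS3_of_sigmaRS3_of_analyticMuZeroAtTwo`), and RawS3 + Kato 17.4 (1)(2) at `2` + modularity +
the period unit at `2` + Matsuno 2008 Thm 4.2 ⇒ C1 `MainConjectureTransportAlignedAtTwo` (`mainConjectureTransportAlignedAtTwo_of_sigmaRawS3`);
RawS3 is NOT weaker than RS3 alone — it carries the `μ`-TRANSFER «`red G₁ ≠ 0 ⇒ red G₂ ≠ 0`» along the congruence
(`muTransfer_and_pfree_eq_of_raw_eq`), the Greenberg–Vatsal Thm. (1.4) shape, in place of the blanket `μ₂`-conjecture. Read-back versus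
`SymbolLineTransferAtTwoSigmaRS3` above: the two binders `IsOrdinaryAt W₁ 2 → IsOrdinaryAt W₂ 2 →` are PREPENDED (good-ordinary pairs only),
`red G₁ ≠ 0 →` is inserted before `∀ S`, and the conclusion is the raw `red (G · 𝒫) = red (G · 𝒫)` instead of `red (pfree …) = red (pfree …)`.
CENSUS / BC5 (att-p1 g3; MEMO-imc D-imc-7/8/9): aligned ⇒ equal on XSYM 105/105 + 2 180/2 180 + 1 201/1 201 decisive instances, `μ = 0` on
both sides of every row (raw = unit-normalised there; the `μ`-transfer is untested as a transfer). MUTATION (REF1 §68): dropping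
`AlignedAtTwo` or `AlignedAtInfinity` is census-refuted (misaligned ⟺ different copy, 84/84); `¬ IsSquare W₁.Δ` is implied by
`¬ IsSquare W₂.Δ` on the shared cubic field (`not_isSquare_Δ_of_shared_cubic_field`) and is kept for the symmetric Part E shape; dropping
`red G₁ ≠ 0` would extend the claim to `μ > 0` pairs (untested). WHY IT MIGHT FAIL: a `2`-adic non-unit ratio between the canonical (EPW)
period and the tree lift's normalisation on one side of an aligned pair, or a failure of «aligned ⇒ same copy» beyond the census range.
Consumer: crux C1 stmt-BirchSwinnertonDyer-22296, line `birth` v7, stub `stub_sigmaRawS3` BY NAME. Nothing asserted.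
[cite: EmertonPollackWeston2006, Thm. 1, §4 Cor. 4.3.3, §§3–5] [cite: GreenbergVatsal2000, Thm. (1.4) and p. 4, §1 (8)–(10)] -/
@[conjecture] def SymbolLineTransferAtTwoSigmaRawS3 : Prop :=
  ∀ (W₁ : WeierstrassCurve ℚ) [W₁.IsElliptic] [W₁.IsGloballyMinimal]
    (W₂ : WeierstrassCurve ℚ) [W₂.IsElliptic] [W₂.IsGloballyMinimal],
    IsOrdinaryAt W₁ 2 → IsOrdinaryAt W₂ 2 →
    (∀ x : ℚ, ¬ HasRationalTwoTorsionX W₁ x) → (∀ x : ℚ, ¬ HasRationalTwoTorsionX W₂ x) →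
    ¬ IsSquare W₁.Δ → ¬ IsSquare W₂.Δ →
    ∀ (F : Type) [Field F] [NumberField F], Module.finrank ℚ F = 3 →
    ∀ e₁ e₂ : F, aeval e₁ (twoDivisionUCubic W₁) = 0 → aeval e₂ (twoDivisionUCubic W₂) = 0 →
    AlignedAtTwo F e₁ e₂ → AlignedAtInfinity F (twoDivisionUCubic W₁) (twoDivisionUCubic W₂) e₁ e₂ →
    ∀ ⦃N₁ : ℕ⦄ [NeZero N₁] (f₁ : CuspForm (Gamma0 N₁) 2), IsNewformOf W₁ f₁ →
    ∀ ⦃N₂ : ℕ⦄ [NeZero N₂] (f₂ : CuspForm (Gamma0 N₂) 2), IsNewformOf W₂ f₂ →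
    ∀ G₁ G₂ : IwasawaAlgebra 2, IsEvenBranchLiftAtTwo W₁ f₁ G₁ → IsEvenBranchLiftAtTwo W₂ f₂ G₂ →
    red G₁ ≠ 0 →
    ∀ S : Finset (HeightOneSpectrum (𝓞 ℚ)),
      (∀ v ∈ S, Rat.HeightOneSpectrum.natGenerator v ≠ 2) →
      (∀ ℓ ∈ (N₁ * N₂).primeFactors, ℓ ≠ 2 → ∃ v ∈ S, Rat.HeightOneSpectrum.natGenerator v = ℓ) →
      red (G₁ * GreenbergVatsal2000.eulerFactorProductInv W₁ 2 S) =
        red (G₂ * GreenbergVatsal2000.eulerFactorProductInv W₂ 2 S)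

end Summit.BirchSwinnertonDyer.Rank1Residual.F1Sign2

end
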